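import Mathlib.NumberTheory.Padics.MahlerBasis
import Literature.RingTheory.Binomial.ChooseDivNatCast
import Summits.BirchSwinnertonDyer.BirchSwinnertonDyer.Theorems.ResidualThetaTransportAtTwoLambdaLowerBoundOEulerFactorUnitPower
import Summits.BirchSwinnertonDyer.BirchSwinnertonDyer.Theorems.ResidualThetaTransportAtTwoLambdaLowerBoundOEulerFactorQuadraticAtTwo
import HarnessLib

/-!
# The two summands of the crux's `Σ_g(S₀)` as λ-invariants at the EXACT Frobenius `Y = (1+T)^{u'·2^k}`
# (`p = 2`, `ℓ` odd, `u'` a `2`-adic unit): `Λ_𝒪/((Y² − aY + ℓ))` has rank `2^k·(if ‖a‖ < 1 then 2 else 0)`,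
# `Λ_𝒪/((ℓ − aY))` has rank `2^k·(if ‖a − 1‖ < 1 then 1 else 0)` — for `Y = B^{2^k}`, any `B` with
# `‖B(0) − 1‖ < 1`, `‖B₁‖ = 1` (crux carriers `padicCoeffIntegers S` / `IwasawaAlgebraO S`), and for
# `B = (1+T)^{u'} = binomialSeries u'` over `𝒪_E`

Route `ResidualThetaTransportAtTwo` (RTT), crux (R≥)ᵖ `ResidualThetaCountLowerPureAtTwo`
(stmt-BirchSwinnertonDyer-26074), line «bt26-lambda», research stub S2 `stub_cmLambdaLower`, (e)/(v) of
`Cruxes/ResidualThetaCountLowerPureAtTwo/PROMOTE-S2.md` (Greenberg–Vatsal local terms of the CM partner `g`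
at the exact Frobenius); width seat `prover-bsd-rtt-w1` g0 (helper (H2c) 2/2; `--supports`, closes nothing).
Sequel of `…LambdaLowerBoundOEulerFactorUnitPower` (general `p`, residue-field hypotheses) and
`…EulerFactorQuadraticAtTwo` (p644557: the case `B = 1 + T`). HONEST FRAMING: THEOREMS ONLY (no definition,
no named fact, no instance, no `sorry`); pure commutative algebra; nothing about any Selmer group or modular
form is asserted; BSD is not proved by any of this.

WHAT. In `Λ_𝒪 = 𝒪⟦T⟧` (`γ ↦ 1+T`, `IsCyclotomicVariable 2 γ`) the Frobenius at an odd prime `ℓ` is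
`γ^{u_ℓ}`, `u_ℓ = u'·2^k`, `k = v₂((ℓ²−1)/8)`, `u' ∈ ℤ₂^×`; its image is `Y = (1+T)^{u_ℓ} = B^{2^k}` with
`B = (1+T)^{u'} = ∑ₙ binom(u',n)Tⁿ = PowerSeries.binomialSeries 𝒪 u'`, `B(0) = 1`, `B₁ = u'`. The crux's
inlined sum `Σ_g(S₀) = ∑_v 2^k·(if ℓ ∣ M then (if ‖ι a_ℓ − 1‖ < 1 then 1 else 0) else (if ‖ι a_ℓ‖ < 1 then 2 else 0))`
is the sum of the λ-invariants of the local Euler-factor modules of `g` AT THIS `Y` (GV Prop. 2.4 over `𝒪`):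

* §1 (over `𝒪_E`, `E/ℚ₂` finite, any `B` with `‖B(0) − 1‖ < 1`, `‖B₁‖ = 1`)
  `residue_ne_zero_iff_norm_eq_one`; **`free_finrank_quotient_span_eulerQuadratic_pow_two`**,
  **`free_finrank_quotient_span_eulerLinear_pow_two`**.
* §2 (`B = binomialSeries 𝒪 u'`, `u'` a unit of `ℤ₂`; exponent written `(2 : ℤ₂)^k · u'`)
  `binomialSeries_two_pow_mul` (`(1+T)^{2^k·r} = ((1+T)^r)^{2^k}`, from the tree's
  `Literature.RingTheory.Binomial.binomialSeries_nsmul`),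
  `norm_coe_algebraMap_padicInt` (`‖u'·1‖ = ‖u'‖`), **`free_finrank_quotient_span_eulerQuadratic_binomialSeries_two`**,
  **`free_finrank_quotient_span_eulerLinear_binomialSeries_two`** — `Y = (1+T)^{2^k·u'}` literally.
* §3 the `B^{2^k}` statements on the crux's own carriers `𝒪 = padicCoeffIntegers S`, `Λ_𝒪 = IwasawaAlgebraO S`
  (norm-phrased, since `padicCoeffIntegers S` carries no `ℤ₂`-algebra instance; transport along
  `padicCoeffIntegers_eq_unitBall`): **`free_finrank_quotient_span_eulerQuadratic_pow_iwasawaAlgebraO`**,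
  **`free_finrank_quotient_span_eulerLinear_pow_iwasawaAlgebraO`**.

References: [GreenbergVatsal2000] §2, Prop. 2.4 and Cor. 2.3; [Washington1997] §7.1 Thm. 7.3, Prop. 13.2;
[NeukirchANT1999] Ch. II (4.8).
-/

set_option autoImplicit false
-- the Theorems namespace of this sub repeats the summit name by design (D-0017 nested layout)
set_option linter.dupNamespace false

noncomputable section

open scoped Classical
open PowerSeries

namespace Summit.BirchSwinnertonDyer.BirchSwinnertonDyer.Theorems.LambdaLowerBoundO

/-! ### §1. Over `𝒪_E`, `E/ℚ₂` finite: `Y = B^{2^k}` with `‖B(0) − 1‖ < 1`, `‖B₁‖ = 1` -/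

section UnitBall

open Literature.NumberTheory.Automorphic

variable (p : ℕ) [Fact p.Prime] (E : IntermediateField ℚ_[p] (PadicAlgCl p))

/-- In `𝒪_E ⊆ ℚ̄_p`: **`x ∉ 𝔪 ↔ ‖x‖ = 1`** (elements of `𝒪_E` have norm `≤ 1`). [cite: NeukirchANT1999, Ch. II (4.8)] -/
theorem residue_ne_zero_iff_norm_eq_one (x : PadicIntermediateField.unitBall p E) :
    IsLocalRing.residue (PadicIntermediateField.unitBall p E) x ≠ 0 ↔ ‖(x : PadicAlgCl p)‖ = 1 := by
  rw [Ne, residue_eq_zero_iff_norm_lt_one p E x, not_lt]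
  have hle : ‖(x : PadicAlgCl p)‖ ≤ 1 := by
    have h := PadicIntermediateField.valued_le_one_of_mem_unitBall p E x.2
    rw [PadicAlgCl.valuation_def, ← NNReal.coe_le_coe, coe_nnnorm, NNReal.coe_one] at h
    exact h
  exact ⟨fun h => le_antisymm hle h, fun h => h.ge⟩

/-- **The `ℓ ∤ M` summand of `Σ_g(S₀)` at `Y = B^{2^k}`** (`p = 2`, `ℓ` odd): over `𝒪 = 𝒪_E`, `E/ℚ₂` finite,
for any `B ∈ Λ_𝒪` with `‖B(0) − 1‖ < 1` and `‖B₁‖ = 1` (e.g. `B = (1+T)^{u'}`, `u'` a `2`-adic unit) and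
`a ∈ 𝒪`, `Λ_𝒪/((Y² − aY + ℓ))` is free over `𝒪` of rank `2^k · (if ‖a‖ < 1 then 2 else 0)`.
[cite: GreenbergVatsal2000, §2 Prop. 2.4] [cite: Washington1997, §7.1 Thm. 7.3] -/
theorem free_finrank_quotient_span_eulerQuadratic_pow_two (E : IntermediateField ℚ_[2] (PadicAlgCl 2))
    [FiniteDimensional ℚ_[2] E] (k : ℕ) {B : PowerSeries (PadicIntermediateField.unitBall 2 E)}
    (hB0 : ‖((constantCoeff B : PadicIntermediateField.unitBall 2 E) : PadicAlgCl 2) - 1‖ < 1)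
    (hB1 : ‖((coeff 1 B : PadicIntermediateField.unitBall 2 E) : PadicAlgCl 2)‖ = 1)
    (a : PadicIntermediateField.unitBall 2 E) {l : ℕ} (hl : Odd l) :
    Module.Free (PadicIntermediateField.unitBall 2 E)
        (PowerSeries (PadicIntermediateField.unitBall 2 E) ⧸
          Ideal.span {(B ^ (2 ^ k)) ^ 2 - C a * B ^ (2 ^ k) + C (l : PadicIntermediateField.unitBall 2 E)}) ∧
      Module.Finite (PadicIntermediateField.unitBall 2 E)
        (PowerSeries (PadicIntermediateField.unitBall 2 E) ⧸
          Ideal.span {(B ^ (2 ^ k)) ^ 2 - C a * B ^ (2 ^ k) + C (l : PadicIntermediateField.unitBall 2 E)}) ∧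
      Module.finrank (PadicIntermediateField.unitBall 2 E)
        (PowerSeries (PadicIntermediateField.unitBall 2 E) ⧸
          Ideal.span {(B ^ (2 ^ k)) ^ 2 - C a * B ^ (2 ^ k) + C (l : PadicIntermediateField.unitBall 2 E)}) =
        2 ^ k * (if ‖(a : PadicAlgCl 2)‖ < 1 then 2 else 0) := by
  haveI := charP_residueField_unitBall 2 E
  have hB0' := (residue_eq_one_iff_norm_sub_one_lt_one 2 E (constantCoeff B)).2 hB0
  have hB1' := (residue_ne_zero_iff_norm_eq_one 2 E (coeff 1 B)).2 hB1
  have hl1 := residue_natCast_eq_one_of_odd E hl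
  have h2 : (2 : IsLocalRing.ResidueField (PadicIntermediateField.unitBall 2 E)) = 0 := CharTwo.two_eq_zero
  by_cases ha : IsLocalRing.residue (PadicIntermediateField.unitBall 2 E) a = 0
  · rw [if_pos ((residue_eq_zero_iff_norm_lt_one 2 E a).1 ha), show (2 : ℕ) ^ k * 2 = 2 * 2 ^ k from mul_comm _ _]
    refine free_finrank_quotient_span_eulerQuadratic_pow_of_eq_zero_of_eq_zero 2 E k hB0' hB1' ?_ ?_
    · rw [ha, hl1, sub_zero, one_add_one_eq_two]
      exact h2
    · rw [ha, sub_zero]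
      exact h2
  · rw [if_neg (fun hn => ha ((residue_eq_zero_iff_norm_lt_one 2 E a).2 hn)), show (2 : ℕ) ^ k * 0 = 0 from mul_zero _]
    refine free_finrank_quotient_span_eulerQuadratic_pow_of_ne_zero 2 E k hB0' ?_
    have hneg : (1 : IsLocalRing.ResidueField (PadicIntermediateField.unitBall 2 E)) -
        IsLocalRing.residue (PadicIntermediateField.unitBall 2 E) a + 1 =
        -IsLocalRing.residue (PadicIntermediateField.unitBall 2 E) a := by
      rw [sub_add_eq_add_sub, one_add_one_eq_two, h2, zero_sub]
    rw [hl1, hneg]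
    exact neg_ne_zero.2 ha

/-- **The `ℓ ∣ M` summand of `Σ_g(S₀)` at `Y = B^{2^k}`** (`p = 2`, `ℓ` odd): over `𝒪 = 𝒪_E`, `E/ℚ₂` finite,
for any `B ∈ Λ_𝒪` with `‖B(0) − 1‖ < 1` and `‖B₁‖ = 1` and `a ∈ 𝒪`, `Λ_𝒪/((ℓ − aY))` is free over `𝒪` of rank
`2^k · (if ‖a − 1‖ < 1 then 1 else 0)`. [cite: GreenbergVatsal2000, §2 Prop. 2.4] [cite: Washington1997, §7.1 Thm. 7.3] -/
theorem free_finrank_quotient_span_eulerLinear_pow_two (E : IntermediateField ℚ_[2] (PadicAlgCl 2))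
    [FiniteDimensional ℚ_[2] E] (k : ℕ) {B : PowerSeries (PadicIntermediateField.unitBall 2 E)}
    (hB0 : ‖((constantCoeff B : PadicIntermediateField.unitBall 2 E) : PadicAlgCl 2) - 1‖ < 1)
    (hB1 : ‖((coeff 1 B : PadicIntermediateField.unitBall 2 E) : PadicAlgCl 2)‖ = 1)
    (a : PadicIntermediateField.unitBall 2 E) {l : ℕ} (hl : Odd l) :
    Module.Free (PadicIntermediateField.unitBall 2 E)
        (PowerSeries (PadicIntermediateField.unitBall 2 E) ⧸
          Ideal.span {C (l : PadicIntermediateField.unitBall 2 E) - C a * B ^ (2 ^ k)}) ∧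
      Module.Finite (PadicIntermediateField.unitBall 2 E)
        (PowerSeries (PadicIntermediateField.unitBall 2 E) ⧸
          Ideal.span {C (l : PadicIntermediateField.unitBall 2 E) - C a * B ^ (2 ^ k)}) ∧
      Module.finrank (PadicIntermediateField.unitBall 2 E)
        (PowerSeries (PadicIntermediateField.unitBall 2 E) ⧸
          Ideal.span {C (l : PadicIntermediateField.unitBall 2 E) - C a * B ^ (2 ^ k)}) =
        2 ^ k * (if ‖(a : PadicAlgCl 2) - 1‖ < 1 then 1 else 0) := by
  have hB0' := (residue_eq_one_iff_norm_sub_one_lt_one 2 E (constantCoeff B)).2 hB0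
  have hB1' := (residue_ne_zero_iff_norm_eq_one 2 E (coeff 1 B)).2 hB1
  have hl1 := residue_natCast_eq_one_of_odd E hl
  by_cases ha : IsLocalRing.residue (PadicIntermediateField.unitBall 2 E) a = 1
  · rw [if_pos ((residue_eq_one_iff_norm_sub_one_lt_one 2 E a).1 ha), show (2 : ℕ) ^ k * 1 = 2 ^ k from mul_one _]
    refine free_finrank_quotient_span_eulerLinear_pow_of_eq 2 E k hB0' hB1' (hl1.trans ha.symm) ?_
    rw [ha]
    exact one_ne_zero
  · rw [if_neg (fun hn => ha ((residue_eq_one_iff_norm_sub_one_lt_one 2 E a).2 hn)),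
      show (2 : ℕ) ^ k * 0 = 0 from mul_zero _]
    refine free_finrank_quotient_span_eulerLinear_pow_of_ne 2 E k hB0' ?_
    rw [hl1]
    exact Ne.symm ha

/-! ### §2. `B = (1+T)^{u'} = binomialSeries 𝒪 u'`, `u'` a `2`-adic unit: `Y = (1+T)^{2^k·u'}` literally -/

omit [Fact p.Prime] in
/-- `(1+T)^{2^k·u'} = ((1+T)^{u'})^{2^k}` with the exponent written in `ℤ₂`. [cite: Washington1997, Prop. 13.2] -/
theorem binomialSeries_two_pow_mul {A : Type*} [CommRing A] [Algebra ℤ_[2] A] (k : ℕ) (u : ℤ_[2]) :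
    binomialSeries A ((2 : ℤ_[2]) ^ k * u) = binomialSeries A u ^ (2 ^ k) := by
  rw [← Literature.RingTheory.Binomial.binomialSeries_nsmul, nsmul_eq_mul, Nat.cast_pow, Nat.cast_ofNat]

/-- `‖u'·1‖ = ‖u'‖` for the structure map `ℤ_p → 𝒪_E ⊆ ℚ̄_p`. [folklore] -/
theorem norm_coe_algebraMap_padicInt (u : ℤ_[p]) :
    ‖((algebraMap ℤ_[p] (PadicIntermediateField.unitBall p E) u : PadicIntermediateField.unitBall p E) :
        PadicAlgCl p)‖ = ‖u‖ := by
  rw [show ((algebraMap ℤ_[p] (PadicIntermediateField.unitBall p E) u : PadicIntermediateField.unitBall p E) :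
      PadicAlgCl p) = algebraMap ℤ_[p] (PadicAlgCl p) u from rfl,
    IsScalarTower.algebraMap_apply ℤ_[p] ℚ_[p] (PadicAlgCl p), PadicInt.algebraMap_apply]
  exact (PadicAlgCl.norm_extends p (u : ℚ_[p])).trans PadicInt.norm_def.symm

/-- `(1+T)^{u'}` has constant term `1`: `‖B(0) − 1‖ = 0 < 1`. [folklore] -/
theorem norm_constantCoeff_binomialSeries_sub_one_lt_one (u : ℤ_[p]) :
    ‖((constantCoeff (binomialSeries (PadicIntermediateField.unitBall p E) u) :
        PadicIntermediateField.unitBall p E) : PadicAlgCl p) - 1‖ < 1 := by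
  rw [binomialSeries_constantCoeff, OneMemClass.coe_one, sub_self, norm_zero]
  exact zero_lt_one

/-- `(1+T)^{u'}` has linear coefficient `u'`, of norm `1` when `u'` is a `p`-adic unit. [folklore] -/
theorem norm_coeff_one_binomialSeries_eq_one {u : ℤ_[p]} (hu : IsUnit u) :
    ‖((coeff 1 (binomialSeries (PadicIntermediateField.unitBall p E) u) :
        PadicIntermediateField.unitBall p E) : PadicAlgCl p)‖ = 1 := by
  rw [binomialSeries_coeff, Ring.choose_one_right, ← Algebra.algebraMap_eq_smul_one,
    norm_coe_algebraMap_padicInt p E u]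
  exact PadicInt.isUnit_iff.1 hu

/-- **The `ℓ ∤ M` summand of `Σ_g(S₀)` at the exact Frobenius `Y = (1+T)^{2^k·u'}`** (`p = 2`, `ℓ` odd, `u'` a
`2`-adic unit): over `𝒪 = 𝒪_E`, `E/ℚ₂` finite, `Λ_𝒪/((Y² − aY + ℓ))` with `Y = binomialSeries 𝒪 (2^k·u')` is free
over `𝒪` of rank `2^k · (if ‖a‖ < 1 then 2 else 0)`. [cite: GreenbergVatsal2000, §2 Prop. 2.4]
[cite: Washington1997, §7.1 Thm. 7.3 and Prop. 13.2] -/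
theorem free_finrank_quotient_span_eulerQuadratic_binomialSeries_two (E : IntermediateField ℚ_[2] (PadicAlgCl 2))
    [FiniteDimensional ℚ_[2] E] (k : ℕ) {u : ℤ_[2]} (hu : IsUnit u) (a : PadicIntermediateField.unitBall 2 E)
    {l : ℕ} (hl : Odd l) :
    Module.Free (PadicIntermediateField.unitBall 2 E)
        (PowerSeries (PadicIntermediateField.unitBall 2 E) ⧸
          Ideal.span {(binomialSeries (PadicIntermediateField.unitBall 2 E) ((2 : ℤ_[2]) ^ k * u)) ^ 2 -
            C a * binomialSeries (PadicIntermediateField.unitBall 2 E) ((2 : ℤ_[2]) ^ k * u) +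
            C (l : PadicIntermediateField.unitBall 2 E)}) ∧
      Module.Finite (PadicIntermediateField.unitBall 2 E)
        (PowerSeries (PadicIntermediateField.unitBall 2 E) ⧸
          Ideal.span {(binomialSeries (PadicIntermediateField.unitBall 2 E) ((2 : ℤ_[2]) ^ k * u)) ^ 2 -
            C a * binomialSeries (PadicIntermediateField.unitBall 2 E) ((2 : ℤ_[2]) ^ k * u) +
            C (l : PadicIntermediateField.unitBall 2 E)}) ∧
      Module.finrank (PadicIntermediateField.unitBall 2 E)
        (PowerSeries (PadicIntermediateField.unitBall 2 E) ⧸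
          Ideal.span {(binomialSeries (PadicIntermediateField.unitBall 2 E) ((2 : ℤ_[2]) ^ k * u)) ^ 2 -
            C a * binomialSeries (PadicIntermediateField.unitBall 2 E) ((2 : ℤ_[2]) ^ k * u) +
            C (l : PadicIntermediateField.unitBall 2 E)}) =
        2 ^ k * (if ‖(a : PadicAlgCl 2)‖ < 1 then 2 else 0) := by
  rw [binomialSeries_two_pow_mul]
  exact free_finrank_quotient_span_eulerQuadratic_pow_two E k
    (norm_constantCoeff_binomialSeries_sub_one_lt_one 2 E u) (norm_coeff_one_binomialSeries_eq_one 2 E hu) a hl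

/-- **The `ℓ ∣ M` summand of `Σ_g(S₀)` at the exact Frobenius `Y = (1+T)^{2^k·u'}`** (`p = 2`, `ℓ` odd, `u'` a
`2`-adic unit): over `𝒪 = 𝒪_E`, `E/ℚ₂` finite, `Λ_𝒪/((ℓ − aY))` with `Y = binomialSeries 𝒪 (2^k·u')` is free over
`𝒪` of rank `2^k · (if ‖a − 1‖ < 1 then 1 else 0)`. [cite: GreenbergVatsal2000, §2 Prop. 2.4]
[cite: Washington1997, §7.1 Thm. 7.3 and Prop. 13.2] -/
theorem free_finrank_quotient_span_eulerLinear_binomialSeries_two (E : IntermediateField ℚ_[2] (PadicAlgCl 2))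
    [FiniteDimensional ℚ_[2] E] (k : ℕ) {u : ℤ_[2]} (hu : IsUnit u) (a : PadicIntermediateField.unitBall 2 E)
    {l : ℕ} (hl : Odd l) :
    Module.Free (PadicIntermediateField.unitBall 2 E)
        (PowerSeries (PadicIntermediateField.unitBall 2 E) ⧸
          Ideal.span {C (l : PadicIntermediateField.unitBall 2 E) -
            C a * binomialSeries (PadicIntermediateField.unitBall 2 E) ((2 : ℤ_[2]) ^ k * u)}) ∧
      Module.Finite (PadicIntermediateField.unitBall 2 E)
        (PowerSeries (PadicIntermediateField.unitBall 2 E) ⧸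
          Ideal.span {C (l : PadicIntermediateField.unitBall 2 E) -
            C a * binomialSeries (PadicIntermediateField.unitBall 2 E) ((2 : ℤ_[2]) ^ k * u)}) ∧
      Module.finrank (PadicIntermediateField.unitBall 2 E)
        (PowerSeries (PadicIntermediateField.unitBall 2 E) ⧸
          Ideal.span {C (l : PadicIntermediateField.unitBall 2 E) -
            C a * binomialSeries (PadicIntermediateField.unitBall 2 E) ((2 : ℤ_[2]) ^ k * u)}) =
        2 ^ k * (if ‖(a : PadicAlgCl 2) - 1‖ < 1 then 1 else 0) := by
  rw [binomialSeries_two_pow_mul]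
  exact free_finrank_quotient_span_eulerLinear_pow_two E k
    (norm_constantCoeff_binomialSeries_sub_one_lt_one 2 E u) (norm_coeff_one_binomialSeries_eq_one 2 E hu) a hl

end UnitBall

/-! ### §3. The `B^{2^k}` statements on the crux's carriers `padicCoeffIntegers S`, `IwasawaAlgebraO S` -/

section CruxCurrency

open Literature.NumberTheory.Automorphic Literature.NumberTheory.EllipticCurves

variable (S : Set (PadicAlgCl 2)) [FiniteDimensional ℚ_[2] (padicCoeffField S)]

/-- **The `ℓ ∤ M` summand of the crux's `Σ_g(S₀)` at `Y = B^{2^k}`**, on the crux's own carriers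
`𝒪 = padicCoeffIntegers S`, `Λ_𝒪 = IwasawaAlgebraO S` (`S = Set.range ι`): for `B ∈ Λ_𝒪` with `‖B(0) − 1‖ < 1`,
`‖B₁‖ = 1` (read `B = (1+T)^{u'}`, `u'` the unit part of the Frobenius exponent), `a ∈ 𝒪` (read
`a = ι(a_ℓ(g))`), `ℓ` odd and `k` (read `k = v₂((ℓ²−1)/8)`), the quotient `Λ_𝒪/((Y² − aY + ℓ))` is free over `𝒪`
of rank `2^k · (if ‖a‖ < 1 then 2 else 0)` — the crux's literal clause. [cite: GreenbergVatsal2000, §2 Prop. 2.4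
and Cor. 2.3] [cite: Washington1997, §7.1 Thm. 7.3] -/
theorem free_finrank_quotient_span_eulerQuadratic_pow_iwasawaAlgebraO :
    ∀ (k : ℕ) (B : IwasawaAlgebraO S) (a : padicCoeffIntegers S) (l : ℕ), Odd l →
      ‖((constantCoeff B : padicCoeffIntegers S) : PadicAlgCl 2) - 1‖ < 1 →
      ‖((coeff 1 B : padicCoeffIntegers S) : PadicAlgCl 2)‖ = 1 →
      Module.Free (padicCoeffIntegers S)
          (IwasawaAlgebraO S ⧸
            Ideal.span {(B ^ (2 ^ k)) ^ 2 - C a * B ^ (2 ^ k) + C (l : padicCoeffIntegers S)}) ∧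
        Module.Finite (padicCoeffIntegers S)
          (IwasawaAlgebraO S ⧸
            Ideal.span {(B ^ (2 ^ k)) ^ 2 - C a * B ^ (2 ^ k) + C (l : padicCoeffIntegers S)}) ∧
        Module.finrank (padicCoeffIntegers S)
          (IwasawaAlgebraO S ⧸
            Ideal.span {(B ^ (2 ^ k)) ^ 2 - C a * B ^ (2 ^ k) + C (l : padicCoeffIntegers S)}) =
          2 ^ k * (if ‖(a : PadicAlgCl 2)‖ < 1 then 2 else 0) := by
  unfold IwasawaAlgebraO
  rw [padicCoeffIntegers_eq_unitBall S]
  intro k B a l hl hB0 hB1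
  exact free_finrank_quotient_span_eulerQuadratic_pow_two (padicCoeffField S) k hB0 hB1 a hl

/-- **The `ℓ ∣ M` summand of the crux's `Σ_g(S₀)` at `Y = B^{2^k}`**, on the crux's own carriers: for `B ∈ Λ_𝒪`
with `‖B(0) − 1‖ < 1`, `‖B₁‖ = 1`, `a ∈ 𝒪`, `ℓ` odd and `k`, the quotient `Λ_𝒪/((ℓ − aY))` is free over `𝒪` of
rank `2^k · (if ‖a − 1‖ < 1 then 1 else 0)` — the crux's literal clause. [cite: GreenbergVatsal2000, §2 Prop. 2.4
and Cor. 2.3] [cite: Washington1997, §7.1 Thm. 7.3] -/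
theorem free_finrank_quotient_span_eulerLinear_pow_iwasawaAlgebraO :
    ∀ (k : ℕ) (B : IwasawaAlgebraO S) (a : padicCoeffIntegers S) (l : ℕ), Odd l →
      ‖((constantCoeff B : padicCoeffIntegers S) : PadicAlgCl 2) - 1‖ < 1 →
      ‖((coeff 1 B : padicCoeffIntegers S) : PadicAlgCl 2)‖ = 1 →
      Module.Free (padicCoeffIntegers S)
          (IwasawaAlgebraO S ⧸ Ideal.span {C (l : padicCoeffIntegers S) - C a * B ^ (2 ^ k)}) ∧
        Module.Finite (padicCoeffIntegers S)
          (IwasawaAlgebraO S ⧸ Ideal.span {C (l : padicCoeffIntegers S) - C a * B ^ (2 ^ k)}) ∧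
        Module.finrank (padicCoeffIntegers S)
          (IwasawaAlgebraO S ⧸ Ideal.span {C (l : padicCoeffIntegers S) - C a * B ^ (2 ^ k)}) =
          2 ^ k * (if ‖(a : PadicAlgCl 2) - 1‖ < 1 then 1 else 0) := by
  unfold IwasawaAlgebraO
  rw [padicCoeffIntegers_eq_unitBall S]
  intro k B a l hl hB0 hB1
  exact free_finrank_quotient_span_eulerLinear_pow_two (padicCoeffField S) k hB0 hB1 a hl

end CruxCurrency

end Summit.BirchSwinnertonDyer.BirchSwinnertonDyer.Theorems.LambdaLowerBoundO

end
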